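import Summits.HubbardSuperconductivity.HubbardSuperconductivity.Theorems.BalabanIRBirComplexStableXYRSplitGlue
import Summits.HubbardSuperconductivity.HubbardSuperconductivity.Theorems.BalabanIRBirSliceXYOrderRPFourier
import Summits.HubbardSuperconductivity.HubbardSuperconductivity.Theorems.BalabanIRBirSliceXYOrderRPSums
import Summits.HubbardSuperconductivity.HubbardSuperconductivity.Theorems.BalabanIRBirComplexStableXYReality
import Summits.HubbardSuperconductivity.HubbardSuperconductivity.Theorems.BirComplexStableXY.Negative.WitnessTable
import HarnessLib

/-!
# BalabanIR crux 2R `BirComplexStableXYR` (stmt-HubbardSuperconductivity-14845): the infrared endgame —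
# mode-by-mode infrared bounds for the COMPLEX measure imply the slice two-point deficit

Support file for line `fat-gaussian-defect-calculus` (lead c6), reshaping the last open stub S5 `stub_singleRegimeRG`
of `Cruxes/BirComplexStableXYR/Lines/fat_gaussian_defect_calculus.lean`.  The engine's second output (slice-averaged
two-point deficit `Re ∫ D e^{−A} ≤ C/(c₀K)·Re Z`, `D = L⁻⁴ Σ_{x,y}(1 − cos(θ_{x,0} − θ_{y,0}))`) is derived from the
momentum-space statement every method of proof produces — an INFRARED BOUND per space-time mode for the complex
measure, `Re ∫ |ẑ_θ(k,q)|² e^{−A} ≤ Γ/(ε_L(k) + ε_M(q)) · Re Z` for `k ≠ 0` (`ẑ_θ(k,q) = Σ_s e^{iθ_s} χ_k(s₁)χ_q(s₂)`) —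
by the Fröhlich–Simon–Spencer endgame of the real calibration `BirSliceXYOrderRP`: slice sum rule
(`BirSliceXY.slice_sum_rule`: only modes with NONZERO spatial momentum enter), slice equivalence, and
`Σ_{k≠0}Σ_q ε(k,q)⁻¹ ≤ 32 L² M` (`BirSliceXY.dispersion_sum_bound`, `L ≤ M`).  No reflection positivity is used: the
weight is an arbitrary continuous complex weight of modulus `≤ 1` (`ir_core`), then the crux's `e^{−A}`.

* `ir_pointwise` — `M Σ_t |Σ_x e^{iθ(x,t)}|² + Σ_{k≠0}Σ_q |ẑ_θ(k,q)|² = (L²M)²` on `Λ L M = (ℤ/L)² × ℤ/M`.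
* `ir_core` — weight-abstract endgame: IR bounds with constant `Γ` ⇒ `Re ∫ D·wt ≤ 32Γ/(L²M) · Re Z`.
* `ir_action_translate`, `ir_sliceSum_translate` — time-translation invariance of the crux's action / slice moments.
* `ir_deficit_of_infrared` — crux weight: IR bounds with `Γ = C·L²M/(c₀K)` ⇒ deficit `≤ 32C/(c₀K)·Re Z`.
* `singleRegimeI3_of_positivity_of_infrared` (registered sub-goal; binder form `…'`) — reshaped composition of S5:
  positivity (S5a) and the complex infrared bound (S5b) on the (I3) class give `SingleRegimeI3`, the hypothesis of
  the landed glue `birComplexStableXYR_of_singleRegimeI3` (p129739), with constant `32·max C 0`.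
[folklore]
-/
set_option linter.dupNamespace false -- summit = problem name (single-conjunct summit), D-0017

noncomputable section

namespace Summit.HubbardSuperconductivity.HubbardSuperconductivity.Theorems

open scoped BigOperators ComplexConjugate
open MeasureTheory Literature.Probability.LatticeModels Complex
open Summit.HubbardSuperconductivity.BirComplexStableXYNegative

section InfraredEndgame

variable {L M : ℕ} [NeZero L] [NeZero M]

/-- The site relabelling `(ℤ/L)² × ℤ/M ≃ (ℤ/L)² × (ℤ/M)¹` used to read the crux's configurations as spins on
the product torus of the `BirSliceXY` Fourier files. [folklore] -/
theorem ir_exists_equiv (L M : ℕ) :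
    ∃ e : Λ L M ≃ TorusSite 2 L × TorusSite 1 M, ∀ s, e s = (s.1, fun _ => s.2) :=
  ⟨{ toFun := fun s => (s.1, fun _ => s.2), invFun := fun p => (p.1, p.2 0), left_inv := fun s => rfl
     right_inv := fun p => by
       rcases p with ⟨x, t⟩
       simp only [Prod.mk.injEq, true_and]
       funext i; rw [Subsingleton.elim i 0] }, fun s => rfl⟩

/-- **The slice sum rule for `z_s = e^{iθ_s}` on `(ℤ/L)² × ℤ/M`:**
`M Σ_t |Σ_x e^{iθ(x,t)}|² + Σ_{k≠0}Σ_q |Σ_s e^{iθ_s} χ_k(s₁)χ_q(s₂)|² = (L²M)²` — Plancherel on the product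
torus (`BirSliceXY.slice_sum_rule`): the `k = 0` modes are exactly the slice sums. [folklore] -/
theorem ir_pointwise (θ : Λ L M → ℝ) :
    (M : ℝ) * ∑ t : ZMod M, ‖∑ x : TorusSite 2 L, cexp (I * (θ (x, t) : ℂ))‖ ^ 2 +
      ∑ k ∈ Finset.univ.erase (0 : TorusSite 2 L), ∑ q : TorusSite 1 M,
        ‖∑ s : Λ L M, cexp (I * (θ s : ℂ)) * (torusChar k s.1 * torusChar q (fun _ => s.2))‖ ^ 2 =
      ((L : ℝ) ^ 2 * M) ^ 2 := by
  obtain ⟨e, he⟩ := ir_exists_equiv L M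
  set ω : TorusSite 2 L × TorusSite 1 M → Fin 2 → ℝ :=
    fun p => ![Real.cos (θ (p.1, p.2 0)), Real.sin (θ (p.1, p.2 0))] with hω_def
  have hω : ∀ p, ω p 0 ^ 2 + ω p 1 ^ 2 = 1 := fun p => by
    simp [hω_def, Real.cos_sq_add_sin_sq]
  have key := BirSliceXY.slice_sum_rule (d := 2) (d' := 1) (L := L) (M := M) ω hω
  have hz : ∀ p : TorusSite 2 L × TorusSite 1 M,
      ((ω p 0 : ℂ) + (ω p 1 : ℂ) * I) = cexp (I * (θ (p.1, p.2 0) : ℂ)) := by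
    intro p
    simp only [hω_def, Matrix.cons_val_zero, Matrix.cons_val_one]
    rw [Complex.ofReal_cos, Complex.ofReal_sin, mul_comm I, Complex.exp_mul_I]
  simp only [hz, pow_one] at key
  -- slice sums: `Σ_{t : (ℤ/M)¹} f (t 0) = Σ_{t : ℤ/M} f t`
  have hslice : ∑ t : TorusSite 1 M, ‖∑ x : TorusSite 2 L, cexp (I * (θ (x, t 0) : ℂ))‖ ^ 2 =
      ∑ t : ZMod M, ‖∑ x : TorusSite 2 L, cexp (I * (θ (x, t) : ℂ))‖ ^ 2 :=
    Fintype.sum_equiv (Equiv.funUnique (Fin 1) (ZMod M)) _ _ (fun t => rfl)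
  -- modes: relabel the site sum through `e`
  have hmode : ∀ (k : TorusSite 2 L) (q : TorusSite 1 M),
      ∑ p : TorusSite 2 L × TorusSite 1 M, cexp (I * (θ (p.1, p.2 0) : ℂ)) * (torusChar k p.1 * torusChar q p.2) =
        ∑ s : Λ L M, cexp (I * (θ s : ℂ)) * (torusChar k s.1 * torusChar q (fun _ => s.2)) := by
    intro k q
    refine (Fintype.sum_equiv e _ _ fun s => ?_).symm
    rw [he s]
  simp only [hmode] at key
  rw [hslice] at key
  linarith

omit [NeZero M] in
/-- Continuity of `θ ↦ |Σ_x e^{iθ(x,t)}|²` (as a complex-valued function). [folklore] -/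
theorem ir_continuous_sliceSq (t : ZMod M) :
    Continuous fun θ : Λ L M → ℝ =>
      (((‖∑ x : TorusSite 2 L, cexp (I * (θ (x, t) : ℂ))‖ ^ 2 : ℝ)) : ℂ) := by
  refine Complex.continuous_ofReal.comp ((continuous_norm.comp ?_).pow 2)
  exact continuous_finsetSum _ fun x _ =>
    Complex.continuous_exp.comp (continuous_const.mul (Complex.continuous_ofReal.comp (continuous_apply _)))

/-- Continuity of `θ ↦ |ẑ_θ(k,q)|²` (as a complex-valued function). [folklore] -/
theorem ir_continuous_modeSq (k : TorusSite 2 L) (q : TorusSite 1 M) :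
    Continuous fun θ : Λ L M → ℝ =>
      (((‖∑ s : Λ L M, cexp (I * (θ s : ℂ)) * (torusChar k s.1 * torusChar q (fun _ => s.2))‖ ^ 2 : ℝ)) : ℂ) := by
  refine Complex.continuous_ofReal.comp ((continuous_norm.comp ?_).pow 2)
  exact continuous_finsetSum _ fun s _ =>
    (Complex.continuous_exp.comp (continuous_const.mul (Complex.continuous_ofReal.comp (continuous_apply _)))).mul
      continuous_const

omit [NeZero M] in
/-- `|Σ_x e^{iθ(x,t)}|² ≤ (L²)²`. [folklore] -/
theorem ir_sliceSq_le (θ : Λ L M → ℝ) (t : ZMod M) :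
    ‖∑ x : TorusSite 2 L, cexp (I * (θ (x, t) : ℂ))‖ ^ 2 ≤ ((L : ℝ) ^ 2) ^ 2 := by
  have h1 : ‖∑ x : TorusSite 2 L, cexp (I * (θ (x, t) : ℂ))‖ ≤ (L : ℝ) ^ 2 := by
    refine (norm_sum_le _ _).trans ?_
    have : ∀ x : TorusSite 2 L, ‖cexp (I * (θ (x, t) : ℂ))‖ = 1 := fun x => by
      rw [mul_comm, Complex.norm_exp_ofReal_mul_I]
    simp only [this, Finset.sum_const, Finset.card_univ, nsmul_eq_mul, mul_one]
    have hc : (Fintype.card (TorusSite 2 L) : ℝ) = (L : ℝ) ^ 2 := by simp [TorusSite, ZMod.card]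
    rw [hc]
  exact pow_le_pow_left₀ (norm_nonneg _) h1 2

/-- `|ẑ_θ(k,q)|² ≤ (L²M)²`. [folklore] -/
theorem ir_modeSq_le (θ : Λ L M → ℝ) (k : TorusSite 2 L) (q : TorusSite 1 M) :
    ‖∑ s : Λ L M, cexp (I * (θ s : ℂ)) * (torusChar k s.1 * torusChar q (fun _ => s.2))‖ ^ 2 ≤
      ((L : ℝ) ^ 2 * M) ^ 2 := by
  have h1 : ‖∑ s : Λ L M, cexp (I * (θ s : ℂ)) * (torusChar k s.1 * torusChar q (fun _ => s.2))‖ ≤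
      (L : ℝ) ^ 2 * M := by
    refine (norm_sum_le _ _).trans ?_
    have : ∀ s : Λ L M, ‖cexp (I * (θ s : ℂ)) * (torusChar k s.1 * torusChar q (fun _ => s.2))‖ = 1 := by
      intro s
      rw [norm_mul, norm_mul, norm_torusChar, norm_torusChar, mul_comm I, Complex.norm_exp_ofReal_mul_I]
      ring
    simp only [this, Finset.sum_const, Finset.card_univ, nsmul_eq_mul, mul_one]
    have hc : (Fintype.card (Λ L M) : ℝ) = (L : ℝ) ^ 2 * M := by
      simp [TorusSite, ZMod.card, Fintype.card_prod]
    rw [hc]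
  exact pow_le_pow_left₀ (norm_nonneg _) h1 2

/-- **Infrared endgame, weight abstract.**  Let `wt` be a continuous complex weight of modulus `≤ 1` on the cube
`[0,2π]^Λ`, `Λ = (ℤ/L)² × ℤ/M`, `L ≤ M`, whose slice second moments `∫ |Σ_x e^{iθ(x,t)}|² wt` do not depend on the
slice `t`, with `Z := ∫ wt`, `0 ≤ Re Z`, and suppose the INFRARED BOUNDS
`Re ∫ |ẑ_θ(k,q)|² wt ≤ Γ/(ε_L(k) + ε_M(q)) · Re Z` for all `k ≠ 0` and all `q` (`Γ ≥ 0`).  Then the slice two-point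
deficit obeys `Re ∫ L⁻⁴Σ_{x,y}(1 − cos(θ_{x,0} − θ_{y,0})) wt ≤ 32Γ/(L²M) · Re Z` (slice sum rule + slice
equivalence + `Σ_{k≠0,q} ε⁻¹ ≤ 32L²M`). [folklore] -/
theorem ir_core (hLM : L ≤ M) (wt : (Λ L M → ℝ) → ℂ) (hwc : Continuous wt) (hwb : ∀ θ, ‖wt θ‖ ≤ 1)
    (hshift : ∀ t : ZMod M,
      ∫ θ in cube L M, (((‖∑ x : TorusSite 2 L, cexp (I * (θ (x, t) : ℂ))‖ ^ 2 : ℝ)) : ℂ) * wt θ =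
        ∫ θ in cube L M, (((‖∑ x : TorusSite 2 L, cexp (I * (θ (x, 0) : ℂ))‖ ^ 2 : ℝ)) : ℂ) * wt θ)
    {Γ : ℝ} (hΓ : 0 ≤ Γ) (hZ : 0 ≤ (∫ θ in cube L M, wt θ).re)
    (hIR : ∀ k ∈ Finset.univ.erase (0 : TorusSite 2 L), ∀ q : TorusSite 1 M,
      (∫ θ in cube L M, (((‖∑ s : Λ L M, cexp (I * (θ s : ℂ)) *
          (torusChar k s.1 * torusChar q (fun _ => s.2))‖ ^ 2 : ℝ)) : ℂ) * wt θ).re ≤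
        Γ / (dispersion (latticeMomentum L k) + dispersion (latticeMomentum M q)) *
          (∫ θ in cube L M, wt θ).re) :
    (∫ θ in cube L M, ((((∑ x : TorusSite 2 L, ∑ y : TorusSite 2 L,
        (1 - Real.cos (θ (x, 0) - θ (y, 0)))) / (L : ℝ) ^ 4 : ℝ)) : ℂ) * wt θ).re ≤
      32 * Γ / ((L : ℝ) ^ 2 * M) * (∫ θ in cube L M, wt θ).re := by
  set Z : ℂ := ∫ θ in cube L M, wt θ with hZdef
  set S : ZMod M → (Λ L M → ℝ) → ℂ := fun t θ =>
    (((‖∑ x : TorusSite 2 L, cexp (I * (θ (x, t) : ℂ))‖ ^ 2 : ℝ)) : ℂ) with hSdef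
  set Md : TorusSite 2 L → TorusSite 1 M → (Λ L M → ℝ) → ℂ := fun k q θ =>
    (((‖∑ s : Λ L M, cexp (I * (θ s : ℂ)) * (torusChar k s.1 * torusChar q (fun _ => s.2))‖ ^ 2 : ℝ)) : ℂ)
    with hMdef
  set X : ℂ := ∫ θ in cube L M, S 0 θ * wt θ with hXdef
  have hL0 : (0 : ℝ) < L := by exact_mod_cast Nat.pos_of_ne_zero (NeZero.ne L)
  have hM0 : (0 : ℝ) < M := by exact_mod_cast Nat.pos_of_ne_zero (NeZero.ne M)
  have hintS : ∀ t, Integrable (fun θ => S t θ * wt θ) (volume.restrict (cube L M)) := fun t =>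
    sg_integrable_mul_weight wt hwc hwb (S t) (ir_continuous_sliceSq t) (((L : ℝ) ^ 2) ^ 2) (fun θ => by
      rw [hSdef]; dsimp only
      rw [Complex.norm_real, Real.norm_eq_abs, abs_of_nonneg (by positivity)]
      exact ir_sliceSq_le θ t)
  have hintM : ∀ k q, Integrable (fun θ => Md k q θ * wt θ) (volume.restrict (cube L M)) := fun k q =>
    sg_integrable_mul_weight wt hwc hwb (Md k q) (ir_continuous_modeSq k q) (((L : ℝ) ^ 2 * M) ^ 2) (fun θ => by
      rw [hMdef]; dsimp only
      rw [Complex.norm_real, Real.norm_eq_abs, abs_of_nonneg (by positivity)]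
      exact ir_modeSq_le θ k q)
  have hint1 : Integrable (fun θ => (1 : ℂ) * wt θ) (volume.restrict (cube L M)) :=
    sg_integrable_mul_weight wt hwc hwb (fun _ => (1 : ℂ)) continuous_const 1 (fun _ => by simp)
  have hint0 : Integrable wt (volume.restrict (cube L M)) := by simpa using hint1
  -- integrate the pointwise sum rule against `wt`
  have hsum : (M : ℂ) * (∑ t : ZMod M, ∫ θ in cube L M, S t θ * wt θ) +
      (∑ k ∈ Finset.univ.erase (0 : TorusSite 2 L), ∑ q : TorusSite 1 M, ∫ θ in cube L M, Md k q θ * wt θ) =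
      ((((L : ℝ) ^ 2 * M) ^ 2 : ℝ) : ℂ) * Z := by
    have hpt : ∀ θ : Λ L M → ℝ, ((M : ℂ) * ∑ t : ZMod M, S t θ +
        ∑ k ∈ Finset.univ.erase (0 : TorusSite 2 L), ∑ q : TorusSite 1 M, Md k q θ) * wt θ =
        ((((L : ℝ) ^ 2 * M) ^ 2 : ℝ) : ℂ) * wt θ := by
      intro θ
      have h := congrArg (fun r : ℝ => (r : ℂ)) (ir_pointwise (L := L) (M := M) θ)
      simp only [Complex.ofReal_add, Complex.ofReal_mul, Complex.ofReal_natCast, Complex.ofReal_sum] at h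
      rw [hSdef, hMdef]
      dsimp only
      rw [← h]
    have hI := integral_congr_ae (μ := volume.restrict (cube L M)) (Filter.Eventually.of_forall hpt)
    rw [integral_const_mul] at hI
    rw [← hI]
    have hintA : Integrable (fun θ => ((M : ℂ) * ∑ t : ZMod M, S t θ) * wt θ) (volume.restrict (cube L M)) := by
      have : (fun θ => ((M : ℂ) * ∑ t : ZMod M, S t θ) * wt θ) =
          fun θ => (M : ℂ) * ∑ t : ZMod M, S t θ * wt θ := by
        funext θ; rw [mul_assoc, Finset.sum_mul]
      rw [this]
      exact (integrable_finsetSum _ fun t _ => hintS t).const_mul _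
    have hintB : Integrable (fun θ => (∑ k ∈ Finset.univ.erase (0 : TorusSite 2 L),
        ∑ q : TorusSite 1 M, Md k q θ) * wt θ) (volume.restrict (cube L M)) := by
      have : (fun θ => (∑ k ∈ Finset.univ.erase (0 : TorusSite 2 L), ∑ q : TorusSite 1 M, Md k q θ) * wt θ) =
          fun θ => ∑ k ∈ Finset.univ.erase (0 : TorusSite 2 L), ∑ q : TorusSite 1 M, Md k q θ * wt θ := by
        funext θ; rw [Finset.sum_mul]
        refine Finset.sum_congr rfl fun k _ => ?_
        rw [Finset.sum_mul]
      rw [this]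
      exact integrable_finsetSum _ fun k _ => integrable_finsetSum _ fun q _ => hintM k q
    have hsplit : ∀ θ : Λ L M → ℝ, ((M : ℂ) * ∑ t : ZMod M, S t θ +
        ∑ k ∈ Finset.univ.erase (0 : TorusSite 2 L), ∑ q : TorusSite 1 M, Md k q θ) * wt θ =
        ((M : ℂ) * ∑ t : ZMod M, S t θ) * wt θ +
          (∑ k ∈ Finset.univ.erase (0 : TorusSite 2 L), ∑ q : TorusSite 1 M, Md k q θ) * wt θ := by
      intro θ; ring
    simp_rw [hsplit]
    rw [integral_add hintA hintB]
    congr 1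
    · have : (fun θ => ((M : ℂ) * ∑ t : ZMod M, S t θ) * wt θ) =
          fun θ => (M : ℂ) * ∑ t : ZMod M, S t θ * wt θ := by
        funext θ; rw [mul_assoc, Finset.sum_mul]
      rw [this, integral_const_mul, integral_finsetSum _ fun t _ => hintS t]
    · have : (fun θ => (∑ k ∈ Finset.univ.erase (0 : TorusSite 2 L), ∑ q : TorusSite 1 M, Md k q θ) * wt θ) =
          fun θ => ∑ k ∈ Finset.univ.erase (0 : TorusSite 2 L), ∑ q : TorusSite 1 M, Md k q θ * wt θ := by
        funext θ; rw [Finset.sum_mul]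
        refine Finset.sum_congr rfl fun k _ => ?_
        rw [Finset.sum_mul]
      rw [this, integral_finsetSum _ fun k _ => integrable_finsetSum _ fun q _ => hintM k q]
      refine Finset.sum_congr rfl fun k _ => ?_
      rw [integral_finsetSum _ fun q _ => hintM k q]
  -- slice equivalence: every slice second moment equals `X`
  have hX : ∑ t : ZMod M, ∫ θ in cube L M, S t θ * wt θ = (M : ℂ) * X := by
    have : ∀ t : ZMod M, ∫ θ in cube L M, S t θ * wt θ = X := fun t => hshift t
    simp only [this, Finset.sum_const, Finset.card_univ, ZMod.card, nsmul_eq_mul]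
  rw [hX] at hsum
  -- real parts
  have hre := congrArg Complex.re hsum
  simp only [Complex.add_re, Complex.mul_re, Complex.re_sum, Complex.natCast_re, Complex.natCast_im,
    Complex.ofReal_re, Complex.ofReal_im, zero_mul, sub_zero] at hre
  -- the infrared sum
  have hIRsum : ∑ k ∈ Finset.univ.erase (0 : TorusSite 2 L), ∑ q : TorusSite 1 M,
      (∫ θ in cube L M, Md k q θ * wt θ).re ≤ Γ * (32 * (L : ℝ) ^ 2 * M) * Z.re := by
    calc ∑ k ∈ Finset.univ.erase (0 : TorusSite 2 L), ∑ q : TorusSite 1 M, (∫ θ in cube L M, Md k q θ * wt θ).re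
        ≤ ∑ k ∈ Finset.univ.erase (0 : TorusSite 2 L), ∑ q : TorusSite 1 M,
            Γ / (dispersion (latticeMomentum L k) + dispersion (latticeMomentum M q)) * Z.re :=
          Finset.sum_le_sum fun k hk => Finset.sum_le_sum fun q _ => hIR k hk q
      _ = Γ * Z.re * ∑ k ∈ Finset.univ.erase (0 : TorusSite 2 L), ∑ q : TorusSite 1 M,
            1 / (dispersion (latticeMomentum L k) + dispersion (latticeMomentum M q)) := by
          rw [Finset.mul_sum]
          refine Finset.sum_congr rfl fun k _ => ?_
          rw [Finset.mul_sum]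
          refine Finset.sum_congr rfl fun q _ => ?_
          ring
      _ ≤ Γ * Z.re * (32 * (L : ℝ) ^ 2 * M) :=
          mul_le_mul_of_nonneg_left (BirSliceXY.dispersion_sum_bound hLM) (mul_nonneg hΓ hZ)
      _ = Γ * (32 * (L : ℝ) ^ 2 * M) * Z.re := by ring
  -- the deficit integral in terms of `X`
  have hD : (∫ θ in cube L M, ((((∑ x : TorusSite 2 L, ∑ y : TorusSite 2 L,
      (1 - Real.cos (θ (x, 0) - θ (y, 0)))) / (L : ℝ) ^ 4 : ℝ)) : ℂ) * wt θ) = Z - X / ((L : ℂ) ^ 4) := by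
    have hpt : ∀ θ : Λ L M → ℝ, ((((∑ x : TorusSite 2 L, ∑ y : TorusSite 2 L,
        (1 - Real.cos (θ (x, 0) - θ (y, 0)))) / (L : ℝ) ^ 4 : ℝ)) : ℂ) * wt θ =
        (1 : ℂ) * wt θ - (1 / (L : ℂ) ^ 4) * (S 0 θ * wt θ) := by
      intro θ
      have h := sg_sliceObs_eq L (fun x => θ (x, 0))
      have hL4 : (L : ℝ) ^ 4 ≠ 0 := by positivity
      have h' : (∑ x : TorusSite 2 L, ∑ y : TorusSite 2 L, (1 - Real.cos (θ (x, 0) - θ (y, 0)))) / (L : ℝ) ^ 4 =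
          1 - ‖∑ x : TorusSite 2 L, cexp (I * (θ (x, 0) : ℂ))‖ ^ 2 / (L : ℝ) ^ 4 := by linarith
      rw [h', hSdef]
      push_cast
      ring
    rw [integral_congr_ae (μ := volume.restrict (cube L M)) (Filter.Eventually.of_forall hpt),
      integral_sub hint1 ((hintS 0).const_mul _), integral_const_mul, integral_const_mul, one_mul, hXdef]
    ring
  rw [hD]
  have hL4re : ∀ w : ℂ, (w / (L : ℂ) ^ 4).re = w.re / (L : ℝ) ^ 4 := by
    intro w
    have : ((L : ℂ) ^ 4) = (((L : ℝ) ^ 4 : ℝ) : ℂ) := by push_cast; ring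
    rw [this, Complex.div_ofReal_re]
  rw [Complex.sub_re, hL4re]
  -- arithmetic: `M·M·Re X + Σ = (L²M)² Re Z`, `Σ ≤ 32ΓL²M Re Z`
  have hXre : ((L : ℝ) ^ 2 * M) ^ 2 * Z.re - Γ * (32 * (L : ℝ) ^ 2 * M) * Z.re ≤ (M : ℝ) * ((M : ℝ) * X.re) := by
    linarith
  have hL2 : (0 : ℝ) < (L : ℝ) ^ 2 := by positivity
  have hL4 : (0 : ℝ) < (L : ℝ) ^ 4 := by positivity
  rw [show 32 * Γ / ((L : ℝ) ^ 2 * M) * Z.re = Z.re - (((L : ℝ) ^ 2 * M) ^ 2 * Z.re -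
      Γ * (32 * (L : ℝ) ^ 2 * M) * Z.re) / ((M : ℝ) * M * (L : ℝ) ^ 4) by
    field_simp; ring]
  have hdiv : (((L : ℝ) ^ 2 * M) ^ 2 * Z.re - Γ * (32 * (L : ℝ) ^ 2 * M) * Z.re) / ((M : ℝ) * M * (L : ℝ) ^ 4) ≤
      X.re / (L : ℝ) ^ 4 := by
    rw [div_le_div_iff₀ (by positivity) hL4]
    have := mul_le_mul_of_nonneg_right hXre hL4.le
    nlinarith
  linarith

end InfraredEndgame

section CruxWeight

variable {r : ℕ}

/-- **Time-translation invariance of the crux's action**: `A(θ ∘ τ_v) = A(θ)` for every space-time shift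
`τ_v(l) = l + v` (re-indexing the sum over window positions, `sh (s + v) w = sh s w + v`). [folklore] -/
theorem ir_action_translate (K : ℝ) (c : Table r) (L M : ℕ) [NeZero L] [NeZero M] (v : Λ L M)
    (θ : Λ L M → ℝ) : action K c L M (fun l => θ (l + v)) = action K c L M θ := by
  have hsh_eq : ∀ (s : Λ L M) (w : W r), sh L M s w =
      s + (![((w.1 : ℕ) : ZMod L), ((w.2.1 : ℕ) : ZMod L)], ((w.2.2 : ℕ) : ZMod M)) := fun s w => rfl
  have hsh : ∀ (s : Λ L M) (w : W r), sh L M s w + v = sh L M (s + v) w := by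
    intro s w; rw [hsh_eq, hsh_eq, add_right_comm]
  unfold action
  congr 1
  simp only [hsh]
  exact Fintype.sum_equiv (Equiv.addRight v) _ _ fun s => rfl

/-- **Slice equivalence**: the slice second moments `∫ |Σ_x e^{iθ(x,t)}|² e^{−A}` of the crux's complex measure
do not depend on the slice `t` (change of variables `θ ↦ θ ∘ τ_{(0,t)}` on the cube, which is measure
preserving, and `ir_action_translate`). [folklore] -/
theorem ir_sliceSum_translate (K : ℝ) (c : Table r) (L M : ℕ) [NeZero L] [NeZero M] (t : ZMod M) :
    ∫ θ in cube L M, (((‖∑ x : TorusSite 2 L, cexp (I * (θ (x, t) : ℂ))‖ ^ 2 : ℝ)) : ℂ) *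
        cexp (-(action K c L M θ)) =
      ∫ θ in cube L M, (((‖∑ x : TorusSite 2 L, cexp (I * (θ (x, 0) : ℂ))‖ ^ 2 : ℝ)) : ℂ) *
        cexp (-(action K c L M θ)) := by
  have key := setIntegral_cube_comp_equiv (Equiv.addRight (((0 : TorusSite 2 L), t) : Λ L M)) 0 (2 * Real.pi)
    (fun θ : Λ L M → ℝ => (((‖∑ x : TorusSite 2 L, cexp (I * (θ (x, 0) : ℂ))‖ ^ 2 : ℝ)) : ℂ) *
      cexp (-(action K c L M θ)))
  simp only [Equiv.coe_addRight, ir_action_translate, Prod.mk_add_mk, add_zero, zero_add] at key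
  unfold cube
  exact key

/-- **Infrared endgame for the crux weight.**  For a (C)-coercive table (`K, c₀ ≥ 0`, so `|e^{−A}| ≤ 1`), `L ≤ M`,
`0 ≤ Re Z` and the infrared bounds `Re ∫ |ẑ_θ(k,q)|² e^{−A} ≤ Γ/(ε_L(k)+ε_M(q)) · Re Z` (`k ≠ 0`, `Γ ≥ 0`):
the slice two-point deficit is `≤ 32Γ/(L²M) · Re Z`. [folklore] -/
theorem ir_deficit_of_infrared (K : ℝ) (c : Table r) {c₀ : ℝ} (hK : 0 ≤ K) (hc₀ : 0 ≤ c₀)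
    (hC : ∀ φ : W r → ℝ, c₀ * ∑ w, ∑ w', (1 - Real.cos (φ w - φ w')) ≤ (genF c φ).re)
    (L M : ℕ) [NeZero L] [NeZero M] (hLM : L ≤ M) {Γ : ℝ} (hΓ : 0 ≤ Γ) (hZ : 0 ≤ (partZ K c L M).re)
    (hIR : ∀ k ∈ Finset.univ.erase (0 : TorusSite 2 L), ∀ q : TorusSite 1 M,
      (∫ θ in cube L M, (((‖∑ s : Λ L M, cexp (I * (θ s : ℂ)) * (torusChar k s.1 * torusChar q (fun _ => s.2))‖ ^ 2 : ℝ)) : ℂ) * cexp (-(action K c L M θ))).re ≤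
        Γ / (dispersion (latticeMomentum L k) + dispersion (latticeMomentum M q)) * (partZ K c L M).re) :
    (∫ θ in cube L M, ((((∑ x : TorusSite 2 L, ∑ y : TorusSite 2 L, (1 - Real.cos (θ (x, 0) - θ (y, 0)))) / (L : ℝ) ^ 4 : ℝ)) : ℂ) * cexp (-(action K c L M θ))).re ≤
      32 * Γ / ((L : ℝ) ^ 2 * M) * (partZ K c L M).re := by
  have hwc : Continuous fun θ : Λ L M → ℝ => cexp (-(action K c L M θ)) :=
    sg_continuous_weight K c (sh L M)
  have hwb : ∀ θ : Λ L M → ℝ, ‖cexp (-(action K c L M θ))‖ ≤ 1 := fun θ =>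
    sg_norm_weight_le_one hK hc₀ c hC (sh L M) θ
  unfold partZ at hZ hIR ⊢
  exact ir_core hLM (fun θ => cexp (-(action K c L M θ))) hwc hwb (ir_sliceSum_translate K c L M) hΓ hZ hIR

/-- **The reshaped composition of stub S5** (line `fat-gaussian-defect-calculus`): on the (I3) class, the bare
positivity `0 < Re Z` (stub S5a `stub_complexPositivityI3`) and the complex INFRARED BOUND per space-time mode with
constant `C·L²M/(c₀K)` (stub S5b `stub_complexInfraredBound`) give the engine's two outputs — `0 < Re Z` and the
slice-averaged two-point deficit `≤ (32·max C 0)/(c₀K) · Re Z` — i.e. the hypothesis `SingleRegimeI3` of the landed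
glue `birComplexStableXYR_of_singleRegimeI3` (p129739).  Thresholds `K₀ = max (max K₀¹ K₀²) 1`, `L₀ = max L₀¹ L₀²`.
[folklore] -/
theorem singleRegimeI3_of_positivity_of_infrared'
    (h1 : ∀ (r : ℕ) (B c₀ : ℝ), 2 ≤ r → 0 < c₀ → ∃ K₀ : ℝ, ∃ L₀ : ℕ, ∀ K : ℝ, K₀ ≤ K → ∀ c : Table r, (∀ n ∈ c.support, ∑ w, n w = 0) → c.sum (fun _ a => a) = 0 → normA c ≤ B → (∀ φ : W r → ℝ, c₀ * ∑ w, ∑ w', (1 - Real.cos (φ w - φ w')) ≤ (genF c φ).re) → (∀ n : Freq r, c (fun w => n (w.1, w.2.1, Fin.rev w.2.2)) = (starRingEnd ℂ) (c (-n))) → (∀ n : Freq r, c (fun w => n (Fin.rev w.1, Fin.rev w.2.1, w.2.2)) = c n) → (∀ v : W r → ℝ, c.sum (fun n a => a.im * (∑ w, (n w : ℝ) * v w) ^ 2) = 0) → ∀ (L M : ℕ) [NeZero L] [NeZero M], L₀ ≤ L → L ≤ M → Even L → Even M → 0 < (partZ K c L M).re)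
    (h2 : ∀ (r : ℕ) (B c₀ : ℝ), 2 ≤ r → 0 < c₀ → ∃ K₀ : ℝ, ∃ L₀ : ℕ, ∃ C : ℝ, ∀ K : ℝ, K₀ ≤ K → ∀ c : Table r, (∀ n ∈ c.support, ∑ w, n w = 0) → c.sum (fun _ a => a) = 0 → normA c ≤ B → (∀ φ : W r → ℝ, c₀ * ∑ w, ∑ w', (1 - Real.cos (φ w - φ w')) ≤ (genF c φ).re) → (∀ n : Freq r, c (fun w => n (w.1, w.2.1, Fin.rev w.2.2)) = (starRingEnd ℂ) (c (-n))) → (∀ n : Freq r, c (fun w => n (Fin.rev w.1, Fin.rev w.2.1, w.2.2)) = c n) → (∀ v : W r → ℝ, c.sum (fun n a => a.im * (∑ w, (n w : ℝ) * v w) ^ 2) = 0) → ∀ (L M : ℕ) [NeZero L] [NeZero M], L₀ ≤ L → L ≤ M → Even L → Even M → ∀ k ∈ Finset.univ.erase (0 : TorusSite 2 L), ∀ q : TorusSite 1 M, (∫ θ in cube L M, (((‖∑ s : Λ L M, cexp (I * (θ s : ℂ)) * (torusChar k s.1 * torusChar q (fun _ => s.2))‖ ^ 2 : ℝ)) : ℂ)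 * cexp (-(action K c L M θ))).re ≤ C * ((L : ℝ) ^ 2 * M) / (c₀ * K * (dispersion (latticeMomentum L k) + dispersion (latticeMomentum M q))) * (partZ K c L M).re) :
    ∀ (r : ℕ) (B c₀ : ℝ), 2 ≤ r → 0 < c₀ → ∃ K₀ : ℝ, ∃ L₀ : ℕ, ∃ C : ℝ, ∀ K : ℝ, K₀ ≤ K → ∀ c : Table r, (∀ n ∈ c.support, ∑ w, n w = 0) → c.sum (fun _ a => a) = 0 → normA c ≤ B → (∀ φ : W r → ℝ, c₀ * ∑ w, ∑ w', (1 - Real.cos (φ w - φ w')) ≤ (genF c φ).re) → (∀ n : Freq r, c (fun w => n (w.1, w.2.1, Fin.rev w.2.2)) = (starRingEnd ℂ) (c (-n))) → (∀ n : Freq r, c (fun w => n (Fin.rev w.1, Fin.rev w.2.1, w.2.2)) = c n) → (∀ v : W r → ℝ, c.sum (fun n a => a.im * (∑ w, (n w : ℝ) * v w) ^ 2) = 0) → ∀ (L M : ℕ) [NeZero L] [NeZero M], L₀ ≤ L → L ≤ M → Even L → Even M → 0 < (partZ K c L M).re ∧ (∫ θ in cube L M, ((((∑ x : TorusSite 2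 L, ∑ y : TorusSite 2 L, (1 - Real.cos (θ (x, 0) - θ (y, 0)))) / (L : ℝ) ^ 4 : ℝ)) : ℂ) * cexp (-(action K c L M θ))).re ≤ C / (c₀ * K) * (partZ K c L M).re := by
  intro r B c₀ hr hc₀
  obtain ⟨K₁, L₁, H1⟩ := h1 r B c₀ hr hc₀
  obtain ⟨K₂, L₂, C₂, H2⟩ := h2 r B c₀ hr hc₀
  refine ⟨max (max K₁ K₂) 1, max L₁ L₂, 32 * max C₂ 0, ?_⟩
  intro K hK c hU1 hN hA hC hR hP hI3 L M _ _ hL0 hLM hLe hMe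
  have hKone : 1 ≤ K := le_trans (le_max_right _ _) hK
  have hKpos : 0 < K := by linarith
  have hpos := H1 K (le_trans (le_trans (le_max_left _ _) (le_max_left _ _)) hK) c hU1 hN hA hC hR hP hI3 L M
    (le_trans (le_max_left _ _) hL0) hLM hLe hMe
  have hir := H2 K (le_trans (le_trans (le_max_right _ _) (le_max_left _ _)) hK) c hU1 hN hA hC hR hP hI3 L M
    (le_trans (le_max_right _ _) hL0) hLM hLe hMe
  refine ⟨hpos, ?_⟩
  have hL : (0 : ℝ) < L := by exact_mod_cast Nat.pos_of_ne_zero (NeZero.ne L)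
  have hM : (0 : ℝ) < M := by exact_mod_cast Nat.pos_of_ne_zero (NeZero.ne M)
  set Γ : ℝ := max C₂ 0 * ((L : ℝ) ^ 2 * M) / (c₀ * K) with hΓdef
  have hΓ : 0 ≤ Γ := by positivity
  have hIR : ∀ k ∈ Finset.univ.erase (0 : TorusSite 2 L), ∀ q : TorusSite 1 M,
      (∫ θ in cube L M, (((‖∑ s : Λ L M, cexp (I * (θ s : ℂ)) * (torusChar k s.1 * torusChar q (fun _ => s.2))‖ ^ 2 : ℝ)) : ℂ) * cexp (-(action K c L M θ))).re ≤
        Γ / (dispersion (latticeMomentum L k) + dispersion (latticeMomentum M q)) * (partZ K c L M).re := by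
    intro k hk q
    refine (hir k hk q).trans ?_
    have hε : 0 ≤ dispersion (latticeMomentum L k) + dispersion (latticeMomentum M q) :=
      add_nonneg (dispersion_nonneg _) (dispersion_nonneg _)
    rw [hΓdef, div_div, show c₀ * K * (dispersion (latticeMomentum L k) + dispersion (latticeMomentum M q)) =
      (c₀ * K) * (dispersion (latticeMomentum L k) + dispersion (latticeMomentum M q)) by ring]
    refine mul_le_mul_of_nonneg_right ?_ hpos.le
    refine div_le_div_of_nonneg_right ?_ (by positivity)
    exact mul_le_mul_of_nonneg_right (le_max_left _ _) (by positivity)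
  have key := ir_deficit_of_infrared K c hKpos.le hc₀.le hC L M hLM hΓ hpos.le hIR
  refine key.trans (le_of_eq ?_)
  rw [hΓdef]
  field_simp

/-- **Registered sub-goal `singleRegimeI3_of_positivity_of_infrared`** (crux stmt-HubbardSuperconductivity-14845, line
`fat-gaussian-defect-calculus`, reshaped stub S5): arrow form of `singleRegimeI3_of_positivity_of_infrared'`.
[folklore] -/
theorem singleRegimeI3_of_positivity_of_infrared : (∀ (r : ℕ) (B c₀ : ℝ), 2 ≤ r → 0 < c₀ → ∃ K₀ : ℝ, ∃ L₀ : ℕ, ∀ K : ℝ, K₀ ≤ K → ∀ c : Table r, (∀ n ∈ c.support, ∑ w, n w = 0) → c.sum (fun _ a => a) = 0 → normA c ≤ B → (∀ φ : W r → ℝ, c₀ * ∑ w, ∑ w', (1 - Real.cos (φ w - φ w')) ≤ (genF c φ).re) → (∀ n : Freq r, c (fun w => n (w.1, w.2.1, Fin.rev w.2.2)) = (starRingEnd ℂ) (c (-n))) → (∀ n : Freq r, c (fun w => n (Fin.rev w.1, Fin.rev w.2.1, w.2.2)) = c n) → (∀ v : W r → ℝ, c.sum (fun n a => a.im * (∑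 w, (n w : ℝ) * v w) ^ 2) = 0) → ∀ (L M : ℕ) [NeZero L] [NeZero M], L₀ ≤ L → L ≤ M → Even L → Even M → 0 < (partZ K c L M).re) → (∀ (r : ℕ) (B c₀ : ℝ), 2 ≤ r → 0 < c₀ → ∃ K₀ : ℝ, ∃ L₀ : ℕ, ∃ C : ℝ, ∀ K : ℝ, K₀ ≤ K → ∀ c : Table r, (∀ n ∈ c.support, ∑ w, n w = 0) → c.sum (fun _ a => a) = 0 → normA c ≤ B → (∀ φ : W r → ℝ, c₀ * ∑ w, ∑ w', (1 - Real.cos (φ w - φ w')) ≤ (genF c φ).re) → (∀ n : Freq r, c (fun w => n (w.1, w.2.1, Fin.rev w.2.2)) = (starRingEnd ℂ) (c (-n))) → (∀ n : Freq r, c (fun w => n (Fin.rev w.1, Fin.rev w.2.1, w.2.2)) = c n) → (∀ v : W r → ℝ, c.sum (fun n a => a.im * (∑ w, (n w : ℝ) * v w) ^ 2) = 0) → ∀ (L M : ℕ) [NeZero L] [NeZero M], L₀ ≤ L → L ≤ M → Even L → Even M → ∀ k ∈ Finset.univ.erase (0 : TorusSite 2 L), ∀ q : TorusSite 1 M, (∫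 θ in cube L M, (((‖∑ s : Λ L M, cexp (I * (θ s : ℂ)) * (torusChar k s.1 * torusChar q (fun _ => s.2))‖ ^ 2 : ℝ)) : ℂ) * cexp (-(action K c L M θ))).re ≤ C * ((L : ℝ) ^ 2 * M) / (c₀ * K * (dispersion (latticeMomentum L k) + dispersion (latticeMomentum M q))) * (partZ K c L M).re) → ∀ (r : ℕ) (B c₀ : ℝ), 2 ≤ r → 0 < c₀ → ∃ K₀ : ℝ, ∃ L₀ : ℕ, ∃ C : ℝ, ∀ K : ℝ, K₀ ≤ K → ∀ c : Table r, (∀ n ∈ c.support, ∑ w, n w = 0) → c.sum (fun _ a => a) = 0 → normA c ≤ B → (∀ φ : W r → ℝ, c₀ * ∑ w, ∑ w', (1 - Real.cos (φ w - φ w')) ≤ (genF c φ).re) → (∀ n : Freq r, c (fun w => n (w.1, w.2.1, Fin.rev w.2.2)) = (starRingEnd ℂ) (c (-n))) → (∀ n : Freq r, c (fun w => n (Fin.rev w.1, Fin.rev w.2.1, w.2.2)) = c n) → (∀ v : W r → ℝ, c.sum (fun n a => a.im * (∑ w, (n w : ℝ) * v w) ^ 2) = 0) → ∀ (L M : ℕ)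 [NeZero L] [NeZero M], L₀ ≤ L → L ≤ M → Even L → Even M → 0 < (partZ K c L M).re ∧ (∫ θ in cube L M, ((((∑ x : TorusSite 2 L, ∑ y : TorusSite 2 L, (1 - Real.cos (θ (x, 0) - θ (y, 0)))) / (L : ℝ) ^ 4 : ℝ)) : ℂ) * cexp (-(action K c L M θ))).re ≤ C / (c₀ * K) * (partZ K c L M).re :=
  fun h1 h2 => singleRegimeI3_of_positivity_of_infrared' h1 h2

end CruxWeight

end Summit.HubbardSuperconductivity.HubbardSuperconductivity.Theorems

end
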